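import Summits.AtomisticToContinuum.Crystallization.Theses.HullExactificationCascade
import Literature.MathematicalPhysics.StatisticalMechanics.LocalMatchingCompactness

/-!
# Route HullExactificationCascade — item 12095 `HullEnergyLowerBound` (J)

Item `stmt-AtomisticToContinuum-12095` (support): for `a ≠ 0`, `h ≠ 0` and a `δ`-separated,
relatively dense `S ⊆ ℝ³` carrying the route's B-inequality (local lower bound, used at `η = 1`
with the `κ`-term dropped) and E-inequality (bulk upper bound), the hcp energy per particle
`e* = e(hcpPeriodicConfiguration a h)` is at most `e_∞ = liminf E(N)/N`.

PROOF (elementary bookkeeping).  Suppose `e_∞ < e*`, `γ := e* − e_∞ > 0`.  On the ball `B_L(0)`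
the two inequalities give `2γ·n_L ≤ εL³ + C(L+1)²`, where `n_L = #(S ∩ B_L(0))`.  Relative
denseness (every point within `R₁ ≤ R := max R₁ 1` of `S`) gives the COVERING count
`(L − R)³ ≤ n_L · R³` (the closed balls of radius `R` about the points of `S ∩ B_L(0)` cover
`B_{L−R}(0)`; compare Haar volumes — `pow_le_card_mul_pow_of_closedBall_subset_biUnion`, the
covering twin of the tree's packing bound `card_le_of_separated_of_dist_le`), finiteness of
`S ∩ B_L(0)` coming from `δ`-separation (`finite_of_forall_le_dist_of_subset_closedBall`).  With
`ε := γ/(8R³)` and `L ≥ max(L₀, 2R, 32R³|C|/γ + 1)` this is contradictory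
(`hullEnergyLowerBound_endgame`).  No literature content (Blanc–Lewin 2015 §2 for context).
-/

open scoped ENNReal
open Metric Set Module MeasureTheory

namespace Summit.AtomisticToContinuum.Crystallization.Theorems

/-- **Covering bound by volume.** In an `n`-dimensional real normed space, if the closed balls of
radius `r ≥ 0` about the points of a finite set `s` cover the closed ball of radius `ρ ≥ 0` about
`p`, then `ρⁿ ≤ #s · rⁿ` (compare additive Haar measures; the covering twin of the packing bound
`Literature.MathematicalPhysics.StatisticalMechanics.card_le_of_separated_of_dist_le`).
[folklore] -/
theorem pow_le_card_mul_pow_of_closedBall_subset_biUnion {E : Type*} [NormedAddCommGroup E]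
    [NormedSpace ℝ E] [FiniteDimensional ℝ E] (s : Finset E) (p : E) {r ρ : ℝ} (hr : 0 ≤ r)
    (hρ : 0 ≤ ρ) (h : closedBall p ρ ⊆ ⋃ c ∈ s, closedBall c r) :
    ρ ^ finrank ℝ E ≤ s.card * r ^ finrank ℝ E := by
  borelize E
  let μ : Measure E := Measure.addHaar
  have I : ENNReal.ofReal (ρ ^ finrank ℝ E) * μ (ball 0 1) ≤
      (s.card : ℝ≥0∞) * ENNReal.ofReal (r ^ finrank ℝ E) * μ (ball 0 1) :=
    calc ENNReal.ofReal (ρ ^ finrank ℝ E) * μ (ball 0 1) = μ (closedBall p ρ) :=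
          (μ.addHaar_closedBall p hρ).symm
      _ ≤ μ (⋃ c ∈ s, closedBall c r) := measure_mono h
      _ ≤ ∑ c ∈ s, μ (closedBall c r) := measure_biUnion_finset_le s _
      _ = (s.card : ℝ≥0∞) * ENNReal.ofReal (r ^ finrank ℝ E) * μ (ball 0 1) := by
          simp only [μ.addHaar_closedBall _ hr, Finset.sum_const, nsmul_eq_mul, mul_assoc]
  have J : ENNReal.ofReal (ρ ^ finrank ℝ E) ≤ (s.card : ℝ≥0∞) * ENNReal.ofReal (r ^ finrank ℝ E) :=
    (ENNReal.mul_le_mul_iff_left (measure_ball_pos μ _ zero_lt_one).ne' measure_ball_lt_top.ne).1 I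
  rw [← ENNReal.ofReal_natCast, ← ENNReal.ofReal_mul (Nat.cast_nonneg _)] at J
  exact (ENNReal.ofReal_le_ofReal_iff (by positivity)).1 J

/-- **Real-arithmetic endgame of item J.** With `γ = e₁ − e₂ > 0`, `R ≥ 1`, `ε = γ/(8R³)`,
`L ≥ 2R` and `L ≥ 32R³|C|/γ + 1`, the local lower bound `2e₁n + κb − C(L+1)² ≤ σ` (`κ, b ≥ 0`),
the bulk upper bound `σ ≤ 2e₂n + εL³` and the covering count `(L − R)³ ≤ nR³` are
contradictory: they force `γL ≤ 32R³|C|`. [folklore] -/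
theorem hullEnergyLowerBound_endgame {e₁ e₂ R C L n b κ σ ε : ℝ} (hlt : e₂ < e₁) (hR : 1 ≤ R)
    (hκ : 0 ≤ κ) (hb : 0 ≤ b) (hε : ε = (e₁ - e₂) / (8 * R ^ 3)) (hL2R : 2 * R ≤ L)
    (hLC : 32 * R ^ 3 * |C| / (e₁ - e₂) + 1 ≤ L)
    (hB : 2 * e₁ * n + κ * b - C * (L + 1) ^ 2 ≤ σ) (hE : σ ≤ 2 * e₂ * n + ε * L ^ 3)
    (hn : (L - R) ^ 3 ≤ n * R ^ 3) : False := by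
  have hγ : 0 < e₁ - e₂ := sub_pos.2 hlt
  have hR3 : 0 < R ^ 3 := by positivity
  have hL1 : 1 ≤ L := by linarith
  have hκb : 0 ≤ κ * b := mul_nonneg hκ hb
  -- the two energy inequalities, κ-term dropped
  have hmain : 2 * (e₁ - e₂) * n ≤ ε * L ^ 3 + C * (L + 1) ^ 2 := by linarith
  -- the covering count: n ≥ L³/(8R³)
  have hcube : (L / 2) ^ 3 ≤ (L - R) ^ 3 := pow_le_pow_left₀ (by linarith) (by linarith) 3
  have hn' : L ^ 3 ≤ 8 * (n * R ^ 3) := by linarith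
  have h1 : (e₁ - e₂) * L ^ 3 ≤ (e₁ - e₂) * (8 * (n * R ^ 3)) :=
    mul_le_mul_of_nonneg_left hn' hγ.le
  have h2 : 4 * R ^ 3 * (2 * (e₁ - e₂) * n) ≤ 4 * R ^ 3 * (ε * L ^ 3 + C * (L + 1) ^ 2) :=
    mul_le_mul_of_nonneg_left hmain (by positivity)
  have h3 : 4 * R ^ 3 * ε = (e₁ - e₂) / 2 := by
    rw [hε]; field_simp; ring
  have hsplit : 4 * R ^ 3 * (ε * L ^ 3 + C * (L + 1) ^ 2) =
      4 * R ^ 3 * ε * L ^ 3 + 4 * R ^ 3 * (C * (L + 1) ^ 2) := by ring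
  rw [hsplit, h3] at h2
  have h4 : (e₁ - e₂) * L ^ 3 ≤ (e₁ - e₂) / 2 * L ^ 3 + 4 * R ^ 3 * (C * (L + 1) ^ 2) := by
    linarith
  -- C(L+1)² ≤ |C|(2L)²
  have h5 : C * (L + 1) ^ 2 ≤ |C| * (2 * L) ^ 2 :=
    calc C * (L + 1) ^ 2 ≤ |C| * (L + 1) ^ 2 :=
          mul_le_mul_of_nonneg_right (le_abs_self C) (by positivity)
      _ ≤ |C| * (2 * L) ^ 2 :=
          mul_le_mul_of_nonneg_left (pow_le_pow_left₀ (by linarith) (by linarith) 2) (abs_nonneg C)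
  have h5' : 4 * R ^ 3 * (C * (L + 1) ^ 2) ≤ 4 * R ^ 3 * (|C| * (2 * L) ^ 2) :=
    mul_le_mul_of_nonneg_left h5 (by positivity)
  have h6 : (e₁ - e₂) * L ^ 3 ≤ 32 * R ^ 3 * |C| * L ^ 2 := by linarith
  have h7 : (e₁ - e₂) * L ≤ 32 * R ^ 3 * |C| := by
    have hL2 : 0 < L ^ 2 := by positivity
    have h7' : (e₁ - e₂) * L * L ^ 2 ≤ 32 * R ^ 3 * |C| * L ^ 2 := by linarith
    exact le_of_mul_le_mul_right h7' hL2
  have h8 : 32 * R ^ 3 * |C| < (e₁ - e₂) * L := by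
    have h8' := mul_le_mul_of_nonneg_left hLC hγ.le
    have hcalc : (e₁ - e₂) * (32 * R ^ 3 * |C| / (e₁ - e₂) + 1) = 32 * R ^ 3 * |C| + (e₁ - e₂) := by
      field_simp
    linarith
  linarith

/-- **Item 12095 `HullEnergyLowerBound`** (route `HullExactificationCascade`, support J, by
name): for `a ≠ 0`, `h ≠ 0` and a `δ`-separated, relatively dense `S ⊆ ℝ³` satisfying the
route's local lower bound (B) and bulk upper bound (E) on balls,
`e(hcpPeriodicConfiguration a h) ≤ liminf_N E(N)/N`.  Proof: B at `η = 1` with the defect term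
dropped, E at `ε = γ/(8R³)`, the covering count `(L − R)³ ≤ n_L R³` on `B_L(0)` and the
real-arithmetic endgame `hullEnergyLowerBound_endgame`. [folklore] -/
theorem hullEnergyLowerBound_proof :
    Summit.AtomisticToContinuum.Crystallization.Theses.HullExactificationCascade.HullEnergyLowerBound := by
  unfold Summit.AtomisticToContinuum.Crystallization.Theses.HullExactificationCascade.HullEnergyLowerBound
  intro a h ha hh S δ hδ hsep hdense hB hE
  by_contra hlt
  push Not at hlt
  set e₁ : ℝ := (Literature.MathematicalPhysics.StatisticalMechanics.hcpPeriodicConfiguration ha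
    hh).energyPerParticle Literature.MathematicalPhysics.StatisticalMechanics.lennardJones with he₁
  set e₂ : ℝ := Filter.liminf (fun N : ℕ =>
    Literature.MathematicalPhysics.StatisticalMechanics.groundStateEnergy
      Literature.MathematicalPhysics.StatisticalMechanics.lennardJones 3 N / (N : ℝ)) Filter.atTop
    with he₂
  obtain ⟨R₁, hR₁⟩ := hdense
  set R : ℝ := max R₁ 1 with hRdef
  have hR1 : 1 ≤ R := le_max_right _ _
  have hRpos : 0 < R := by linarith
  have hγ : 0 < e₁ - e₂ := sub_pos.2 hlt
  obtain ⟨κ, hκ, C, hBall⟩ := hB 1 one_pos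
  set ε : ℝ := (e₁ - e₂) / (8 * R ^ 3) with hεdef
  have hε : 0 < ε := by positivity
  obtain ⟨L₀, hL₀⟩ := hE ε hε
  set L : ℝ := max (max L₀ (2 * R)) (32 * R ^ 3 * |C| / (e₁ - e₂) + 1) with hLdef
  have hLL₀ : L₀ ≤ L := (le_max_left _ _).trans (le_max_left _ _)
  have hL2R : 2 * R ≤ L := (le_max_right _ _).trans (le_max_left _ _)
  have hLC : 32 * R ^ 3 * |C| / (e₁ - e₂) + 1 ≤ L := le_max_right _ _
  have hL0 : 0 ≤ L := by linarith
  have hB' := hBall 0 L hL0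
  have hE' := hL₀ L hLL₀ 0
  -- the finite set S ∩ B_L(0) and the covering count
  set F : Set (EuclideanSpace ℝ (Fin 3)) :=
    {y : EuclideanSpace ℝ (Fin 3) | y ∈ S ∧ dist y (0 : EuclideanSpace ℝ (Fin 3)) ≤ L} with hFdef
  have hFfin : F.Finite :=
    Literature.MathematicalPhysics.StatisticalMechanics.finite_of_forall_le_dist_of_subset_closedBall
      hδ (fun p hp q hq hpq => hsep p hp.1 q hq.1 hpq) (c := 0) (R := L)
      (fun y hy => mem_closedBall.2 hy.2)
  have hcount : (L - R) ^ 3 ≤ (F.ncard : ℝ) * R ^ 3 := by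
    have hcov : closedBall (0 : EuclideanSpace ℝ (Fin 3)) (L - R) ⊆
        ⋃ y ∈ hFfin.toFinset, closedBall y R := by
      intro p hp
      obtain ⟨y, hyS, hyp⟩ := hR₁ p
      have hyp' : dist y p ≤ R := hyp.trans (le_max_left _ _)
      have hyF : y ∈ F := ⟨hyS, by
        calc dist y 0 ≤ dist y p + dist p 0 := dist_triangle _ _ _
          _ ≤ R + (L - R) := add_le_add hyp' (mem_closedBall.1 hp)
          _ = L := by ring⟩
      exact mem_iUnion₂.2 ⟨y, hFfin.mem_toFinset.2 hyF, mem_closedBall.2 (by rw [dist_comm]; exact hyp')⟩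
    have hvol := pow_le_card_mul_pow_of_closedBall_subset_biUnion hFfin.toFinset 0 hRpos.le
      (by linarith) hcov
    rw [finrank_euclideanSpace_fin, ← Set.ncard_eq_toFinset_card F hFfin] at hvol
    exact hvol
  exact hullEnergyLowerBound_endgame hlt hR1 hκ.le (Nat.cast_nonneg _) hεdef hL2R hLC hB' hE' hcount

end Summit.AtomisticToContinuum.Crystallization.Theorems
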